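import Mathlib
import Literature.MathematicalPhysics.QuantumFieldTheory.AnisotropicTwistedPartitionFunction
import HarnessLib

/-!
# The spreading link field of a spatial twist on the anisotropic `Fin`-box (combinatorial half of the U(1) Coulomb witness,
# aside item stmt-QuantumFields-26660 of route `MagneticFluxCeiling`)

For a spatial plane `q = (i, j)` of the box `L_s³ × L_t` and an angle `θ` an explicit link field `λ = spread θ q` (phases on the
`i`-links at `x_i = 0` and on the `j`-links, read off the coordinates `x_i, x_j`) is constructed whose ABELIAN coboundary moves
't Hooft's point twist `e^{iθ}` on the stack `{x_i = 0 = x_j}` to the uniform phase `e^{iθ/L_s²}` on every `q`-plaquette and is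
trivial on all other plaquettes (`stack_mul_cob_spread`).  Also: in an abelian group a link-wise translation multiplies each
plaquette holonomy by the coboundary (`finTorusPlaquette_mul`) and link-wise inversion inverts it (`finTorusPlaquette_inv`).
Route-independent (Literature imports only).  No summit is proved; the Yang–Mills mass gap is NOT proved.
-/

noncomputable section

open MeasureTheory Filter Topology Function
open Literature.MathematicalPhysics.QuantumFieldTheory

namespace Summit.QuantumFields.YangMills.Theorems.MagneticFluxCeiling.AbelianWitness

/-! ### Coordinates and shifts of the `Fin`-box -/

section Coord

variable {n₀ n₁ n₂ n₃ : ℕ}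

/-- The side lengths of the box, by axis. [problem-side] -/
def side (n₀ n₁ n₂ n₃ : ℕ) : Fin 4 → ℕ := ![n₀, n₁, n₂, n₃]

/-- Shifting along `μ` increments the `μ`-th coordinate modulo its side and fixes the others. [problem-side] -/
theorem coord_shift (x : FinTorusSite n₀ n₁ n₂ n₃) (μ ν : Fin 4) :
    finTorusSiteCoord (x.shift μ) ν =
      if ν = μ then (finTorusSiteCoord x μ + 1) % side n₀ n₁ n₂ n₃ μ else finTorusSiteCoord x ν := by
  fin_cases μ <;> fin_cases ν <;> simp [FinTorusSite.shift, finTorusSiteCoord, side, Fin.val_add]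

/-- A coordinate is below its side. [problem-side] -/
theorem coord_lt_side (x : FinTorusSite n₀ n₁ n₂ n₃) (μ : Fin 4) : finTorusSiteCoord x μ < side n₀ n₁ n₂ n₃ μ := by
  fin_cases μ <;> simp [finTorusSiteCoord, side]

end Coord

/-! ### Abelian coboundaries: a link-wise translation multiplies each plaquette by `δλ` -/

section Coboundary

variable {G : Type*} [CommGroup G] {n₀ n₁ n₂ n₃ : ℕ}

/-- The plaquette coboundary of a link field `λ`: `λ(x,μ) λ(x+μ̂,ν) λ(x+ν̂,μ)⁻¹ λ(x,ν)⁻¹`. [problem-side] -/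
def cob (lam : FinTorusSite n₀ n₁ n₂ n₃ × Fin 4 → G) (x : FinTorusSite n₀ n₁ n₂ n₃) (μ ν : Fin 4) : G :=
  lam (x, μ) * lam (x.shift μ, ν) * (lam (x.shift ν, μ))⁻¹ * (lam (x, ν))⁻¹

/-- **Abelian groups: translating every link multiplies the plaquette holonomy by the coboundary.** [problem-side] -/
theorem finTorusPlaquette_mul (lam U : FinTorusSite n₀ n₁ n₂ n₃ × Fin 4 → G) (x : FinTorusSite n₀ n₁ n₂ n₃) (μ ν : Fin 4) :
    finTorusPlaquette (fun l => lam l * U l) x μ ν = cob lam x μ ν * finTorusPlaquette U x μ ν := by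
  simp only [finTorusPlaquette, cob, mul_inv_rev]
  simp only [mul_assoc, mul_comm, mul_left_comm]

/-- **Abelian groups: link-wise inversion inverts the plaquette holonomy.** [problem-side] -/
theorem finTorusPlaquette_inv (U : FinTorusSite n₀ n₁ n₂ n₃ × Fin 4 → G) (x : FinTorusSite n₀ n₁ n₂ n₃) (μ ν : Fin 4) :
    finTorusPlaquette (fun l => (U l)⁻¹) x μ ν = (finTorusPlaquette U x μ ν)⁻¹ := by
  simp only [finTorusPlaquette, mul_inv_rev, inv_inv]
  simp only [mul_assoc, mul_comm, mul_left_comm]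

end Coboundary

/-! ### The spreading link field of a spatial plane `q = (i, j)` of the box `L_s³ × L_t` -/

section Spread

variable {Ls Lt : ℕ}

/-- Phase on the `i`-links at `x_i = 0`: `θ(1 − b/L_s)` at `x_j = b ≥ 1`, `0` at `b = 0`. [problem-side] -/
def phaseA (θ : ℝ) (Ls : ℕ) (a b : ℕ) : ℝ :=
  if a = 0 then (if b = 0 then 0 else θ * (1 - (b : ℝ) / (Ls : ℝ))) else 0

/-- Phase on the `j`-links: `aθ/L_s² − [a ≥ 1]·θ/L_s` at `x_i = a`. [problem-side] -/
def phaseC (θ : ℝ) (Ls : ℕ) (a : ℕ) : ℝ :=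
  (a : ℝ) * θ / ((Ls : ℝ) ^ 2) - (if a = 0 then 0 else θ / (Ls : ℝ))

/-- **The spreading link field** `λ` of the plane `q = (i, j)`: `e^{i·phaseA}` on `i`-links, `e^{i·phaseC}` on `j`-links, `1` on
the others (phases read off the coordinates `x_i, x_j`). [problem-side] -/
def spread (θ : ℝ) (q : {p : Fin 4 × Fin 4 // p.1 < p.2}) (l : FinTorusSite Ls Ls Ls Lt × Fin 4) : Circle :=
  if l.2 = q.1.1 then Circle.exp (phaseA θ Ls (finTorusSiteCoord l.1 q.1.1) (finTorusSiteCoord l.1 q.1.2))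
  else if l.2 = q.1.2 then Circle.exp (phaseC θ Ls (finTorusSiteCoord l.1 q.1.1))
  else 1

/-- The telescoping of `phaseA` along `j`: `A(a,b) − A(a,(b+1) mod L_s) = [a = 0]·(θ/L_s − [b = 0]·θ)` for `b < L_s`. [problem-side] -/
theorem phaseA_sub (θ : ℝ) (hLs : 1 ≤ Ls) {a b : ℕ} (hb : b < Ls) :
    phaseA θ Ls a b - phaseA θ Ls a ((b + 1) % Ls) =
      if a = 0 then θ / (Ls : ℝ) - (if b = 0 then θ else 0) else 0 := by
  have hLs0 : (Ls : ℝ) ≠ 0 := by exact_mod_cast (by omega : Ls ≠ 0)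
  by_cases ha : a = 0
  · subst ha
    rcases Nat.lt_or_ge (b + 1) Ls with h1 | h1
    · rw [Nat.mod_eq_of_lt h1]
      by_cases hb0 : b = 0
      · subst hb0
        simp [phaseA]
        ring
      · simp [phaseA, hb0]
        ring
    · have hbe : b + 1 = Ls := by omega
      rw [hbe, Nat.mod_self]
      by_cases hb0 : b = 0
      · subst hb0
        simp [phaseA]
        rw [← hbe]; simp
      · simp [phaseA, hb0]
        have : (b : ℝ) = (Ls : ℝ) - 1 := by
          have : ((b + 1 : ℕ) : ℝ) = (Ls : ℝ) := by exact_mod_cast hbe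
          push_cast at this; linarith
        rw [this]; field_simp; ring
  · simp [phaseA, ha]

/-- The telescoping of `phaseC` along `i`: `C((a+1) mod L_s) − C(a) = θ/L_s² − [a = 0]·θ/L_s` for `a < L_s`. [problem-side] -/
theorem phaseC_sub (θ : ℝ) (hLs : 1 ≤ Ls) {a : ℕ} (ha : a < Ls) :
    phaseC θ Ls ((a + 1) % Ls) - phaseC θ Ls a = θ / ((Ls : ℝ) ^ 2) - (if a = 0 then θ / (Ls : ℝ) else 0) := by
  have hLs0 : (Ls : ℝ) ≠ 0 := by exact_mod_cast (by omega : Ls ≠ 0)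
  rcases Nat.lt_or_ge (a + 1) Ls with h1 | h1
  · rw [Nat.mod_eq_of_lt h1]
    by_cases ha0 : a = 0
    · subst ha0; simp [phaseC]
    · simp [phaseC, ha0]
      ring
  · have hae : a + 1 = Ls := by omega
    rw [hae, Nat.mod_self]
    by_cases ha0 : a = 0
    · subst ha0
      simp [phaseC]
      rw [← hae]; simp
    · simp [phaseC, ha0]
      have : (a : ℝ) = (Ls : ℝ) - 1 := by
        have : ((a + 1 : ℕ) : ℝ) = (Ls : ℝ) := by exact_mod_cast hae
        push_cast at this; linarith
      rw [this]; field_simp; ring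

/-- The sides of the twisted plane are both `L_s` (the plane is spatial). [problem-side] -/
theorem side_eq_of_ne_three {μ : Fin 4} (hμ : μ ≠ 3) : side Ls Ls Ls Lt μ = Ls := by
  fin_cases μ <;> simp [side] at hμ ⊢

/-- Off the two directions of the plane the spreading field is trivial. [problem-side] -/
theorem spread_of_ne (θ : ℝ) (q : {p : Fin 4 × Fin 4 // p.1 < p.2}) (y : FinTorusSite Ls Ls Ls Lt) {κ : Fin 4}
    (h₁ : κ ≠ q.1.1) (h₂ : κ ≠ q.1.2) : spread θ q (y, κ) = 1 := by
  simp [spread, h₁, h₂]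

/-- Shifting along a direction off the plane does not change the spreading field (it reads only the plane's coordinates).
[problem-side] -/
theorem spread_shift_of_ne (θ : ℝ) (q : {p : Fin 4 × Fin 4 // p.1 < p.2}) (y : FinTorusSite Ls Ls Ls Lt) {κ : Fin 4}
    (h₁ : κ ≠ q.1.1) (h₂ : κ ≠ q.1.2) (μ : Fin 4) : spread θ q (y.shift κ, μ) = spread θ q (y, μ) := by
  have hi : finTorusSiteCoord (y.shift κ) q.1.1 = finTorusSiteCoord y q.1.1 := by
    rw [coord_shift, if_neg (Ne.symm h₁)]
  have hj : finTorusSiteCoord (y.shift κ) q.1.2 = finTorusSiteCoord y q.1.2 := by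
    rw [coord_shift, if_neg (Ne.symm h₂)]
  simp only [spread, hi, hj]

/-- **The spreading field moves the point twist to the uniform phase**: for a spatial plane `q` of the box `L_s³ × L_t` (`L_s ≥ 1`),
on every plaquette `(x; q')` the stack factor (`e^{iθ}` on `q`-plaquettes with `x_i = 0 = x_j`, else `1`) times the coboundary of
`spread θ q` equals `e^{iθ/L_s²}` if `q' = q` and `1` otherwise. [problem-side] -/
theorem stack_mul_cob_spread (θ : ℝ) (hLs : 1 ≤ Ls) (q : {p : Fin 4 × Fin 4 // p.1 < p.2}) (hq : q.1.2 ≠ 3)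
    (x : FinTorusSite Ls Ls Ls Lt) (q' : {p : Fin 4 × Fin 4 // p.1 < p.2}) :
    (if q' = q ∧ finTorusSiteCoord x q.1.1 = 0 ∧ finTorusSiteCoord x q.1.2 = 0 then Circle.exp θ else 1) *
        cob (spread θ q) x q'.1.1 q'.1.2 =
      if q' = q then Circle.exp (θ / ((Ls : ℝ) ^ 2)) else 1 := by
  obtain ⟨⟨i, j⟩, hij⟩ := q
  obtain ⟨⟨μ, ν⟩, hμν⟩ := q'
  simp only at hij hμν hq ⊢
  have hji : j ≠ i := ne_of_gt hij
  have hi3 : i ≠ 3 := by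
    intro h
    have h1 : (j : ℕ) < 4 := j.isLt
    have h2 : (i : ℕ) < (j : ℕ) := hij
    rw [h] at h2
    simp at h2
    omega
  -- coordinates of the plane and their shifts
  set a := finTorusSiteCoord x i with ha_def
  set b := finTorusSiteCoord x j with hb_def
  have ha_lt : a < Ls := by simpa [side_eq_of_ne_three hi3] using coord_lt_side (n₀ := Ls) (n₁ := Ls) (n₂ := Ls) (n₃ := Lt) x i
  have hb_lt : b < Ls := by simpa [side_eq_of_ne_three hq] using coord_lt_side (n₀ := Ls) (n₁ := Ls) (n₂ := Ls) (n₃ := Lt) x j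
  by_cases hcase : μ = i ∧ ν = j
  · -- the twisted plane itself
    obtain ⟨rfl, rfl⟩ := hcase
    have hii : finTorusSiteCoord (x.shift μ) μ = (a + 1) % Ls := by
      rw [coord_shift, if_pos rfl, side_eq_of_ne_three hi3]
    have hji' : finTorusSiteCoord (x.shift ν) μ = a := by
      rw [coord_shift, if_neg (ne_of_lt hμν)]
    have hjj : finTorusSiteCoord (x.shift ν) ν = (b + 1) % Ls := by
      rw [coord_shift, if_pos rfl, side_eq_of_ne_three hq]
    have e1 := phaseA_sub θ hLs (a := a) hb_lt
    have e2 := phaseC_sub θ hLs ha_lt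
    simp only [cob, spread, if_true, hji, if_false, hii, hji', hjj, true_and]
    rw [← ha_def, ← hb_def]
    by_cases ha0 : a = 0
    · by_cases hb0 : b = 0
      · simp only [ha0, hb0, and_self, if_true] at e1 e2 ⊢
        rw [← Circle.exp_neg, ← Circle.exp_neg, ← Circle.exp_add, ← Circle.exp_add, ← Circle.exp_add, ← Circle.exp_add]
        congr 1
        linarith
      · simp only [ha0, hb0, and_false, if_false, if_true, one_mul] at e1 e2 ⊢
        rw [← Circle.exp_neg, ← Circle.exp_neg, ← Circle.exp_add, ← Circle.exp_add, ← Circle.exp_add]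
        congr 1
        linarith
    · simp only [ha0, false_and, if_false, one_mul] at e1 e2 ⊢
      rw [← Circle.exp_neg, ← Circle.exp_neg, ← Circle.exp_add, ← Circle.exp_add, ← Circle.exp_add]
      congr 1
      linarith
  · -- every other plane: the stack factor is `1` and the coboundary cancels
    simp only [Subtype.mk.injEq, Prod.mk.injEq, hcase, false_and, if_false, one_mul]
    by_cases hμ : μ = i ∨ μ = j
    · by_cases hν : ν = i ∨ ν = j
      · exfalso
        rcases hμ with rfl | rfl <;> rcases hν with h | h
        · exact absurd h (ne_of_gt hμν)
        · exact hcase ⟨rfl, h⟩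
        · rw [h] at hμν; exact lt_asymm hij hμν
        · exact absurd h (ne_of_gt hμν)
      · push Not at hν
        simp only [cob, fun y => spread_of_ne θ ⟨(i, j), hij⟩ y hν.1 hν.2,
          fun κ => spread_shift_of_ne θ ⟨(i, j), hij⟩ x hν.1 hν.2 κ, mul_one, inv_one, mul_inv_cancel]
    · push Not at hμ
      by_cases hν : ν = i ∨ ν = j
      · simp only [cob, fun y => spread_of_ne θ ⟨(i, j), hij⟩ y hμ.1 hμ.2,
          fun κ => spread_shift_of_ne θ ⟨(i, j), hij⟩ x hμ.1 hμ.2 κ, one_mul, inv_one, mul_one, mul_inv_cancel]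
      · push Not at hν
        simp only [cob, fun y => spread_of_ne θ ⟨(i, j), hij⟩ y hμ.1 hμ.2, fun y => spread_of_ne θ ⟨(i, j), hij⟩ y hν.1 hν.2,
          inv_one, mul_one]

end Spread




end Summit.QuantumFields.YangMills.Theorems.MagneticFluxCeiling.AbelianWitness

end
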